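import Mathlib.AlgebraicGeometry.EllipticCurve.DivisionPolynomial.Basic
import Mathlib.AlgebraicGeometry.EllipticCurve.Affine.Point
import Mathlib.FieldTheory.IsAlgClosed.Basic
import HarnessLib

/-!
# The `3`-torsion of a Weierstrass curve by radicals: `x(E[3])`, the resolvent of `Ψ₃`, and `y²`

`Proofs` file (theorems only, no definitions, no named facts) in topic
`NumberTheory/EllipticCurves`, landed by the seat of bsd.S15
(`Literature.NumberTheory.EllipticCurves.conductorNorm_eq_artinConductorNat`) as shared algebra for
the **Galois side of Ogg's formula at the places above `2`** (Silverman, *ATAEC* IV.11.1, case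
`p = 2`, PDF p. 366: referred to Saito, no printed case analysis): there the wild conductor is read
on the `3`-division field `K(E[3])` and on its subfield `K(x(E[3]))`
(`ThreeTorsionCentralInvolutionSwanProofs`, `DivisionField`), and both fields are generated by the
explicit radicals of this file — a cube root of `Δ` and three square roots whose product is `c₆`.

## The formulas (any commutative ring)

Let `z = 12x + b₂`.  Then

* `twelve_pow_four_mul_eval_Ψ₃` — **`12⁴ · Ψ₃(x) = 3 · Q(z)`**,
  `Q(z) = z⁴ - 6c₄z² - 8c₆z - 3c₄²` (the `3`-division polynomial of `Y² = X³ - 27c₄X - 54c₆` at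
  `X = 3z`; uses `4b₈ = b₂b₆ - b₄²`);
* `mul_Ψ₂Sq_eval_eq` — **`432 · (4x³ + b₂x² + 2b₄x + b₆) = z³ - 3c₄z - 2c₆`**, and
  `(2y + a₁x + a₃)² = 4x³ + b₂x² + 2b₄x + b₆` on the curve (`sq_two_mul_add_eq_of_equation`).

Let `ω² + ω + 1 = 0`, `δ` arbitrary ("`δ = ∛Δ`"), `A_k = c₄ - 12ωᵏδ` (`k = 0, 1, 2`), and
`U₀² = A₀`, `U₁² = A₁`, `U₂² = A₂`, `U₀U₁U₂ = c₆` (consistent, since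
`A₀A₁A₂ = c₄³ - 1728δ³` (`prod_c₄_sub_twelve_mul`) `= c₆²` when `δ³ = Δ`, Mathlib's
`c_relation`).  Then

* `quartic_eval_sum_eq_zero` — **`Q(U₀ + U₁ + U₂) = 0`**; the sign changes
  `(U₀, -U₁, -U₂)`, `(-U₀, U₁, -U₂)`, `(-U₀, -U₁, U₂)` preserve the hypotheses, so the four numbers
  `x = (-b₂ ± U₀ ± U₁ ± U₂)/12` (even number of minus signs) are roots of `Ψ₃`
  (`eval_Ψ₃_eq_zero_of_twelve_mul_add_eq`, `12` a unit) — Euler's solution of the quartic, whose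
  **resolvent cubic is `(θ - b₄/3)³ + δ³/27`**:
  `(12x₁)(12x₂) + (12x₃)(12x₄) = 48(b₄ - δ)` for the two pairs of roots sharing the sign of `U₀`
  (`pair_mul_add_pair_mul_eq`, `mul_pair_sum_eq`), i.e. `x₁x₂ + x₃x₄ = (b₄ - δ)/3`, and likewise
  `(b₄ - ωδ)/3`, `(b₄ - ω²δ)/3` (`pair_mul_add_pair_mul_eq_one/_two`):
  **`∛Δ = b₄ - 3(x₁x₂ + x₃x₄) ∈ K(x(E[3]))`**;
* `cube_sum_sub_eq` — **`z³ - 3c₄z - 2c₆ = 4(c₆ + Σ_k (c₄ + 6ωᵏδ)U_k)`** at `z = U₀ + U₁ + U₂`,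
  so that on the curve `108 · (2y + a₁x + a₃)² = c₆ + Σ_k (c₄ + 6ωᵏδ) U_k` (`2` a unit;
  `mul_sq_two_mul_add_eq`): the Kummer generator of the quadratic layer
  `K(E[3]) = K(x(E[3]))(2y_P + a₁x_P + a₃)`;
* `exists_radicals` — over an algebraically closed field, `ω, δ, U₀, U₁, U₂` with all the
  relations and `δ³ = Δ` exist.

So `K(x(E[3])) ⊇ K(ω, ∛Δ, √(c₄ - 12∛Δ), √(c₄ - 12ω∛Δ), √(c₄ - 12ω²∛Δ))` with the `x`-coordinates
rational in these radicals (the product of the three square roots being `c₆`), and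
`K(E[3]) = K(x(E[3]))(√(c₆ + Σ_k (c₄ + 6ωᵏ∛Δ)U_k))`.  At a place of residue characteristic `2`
this exhibits the tame layer `K(∛Δ)` of the `3`-division field (the inertia group of `K(E[3])` has
order divisible by `3` iff `3 ∤ ord Δ`), the four-group layer as Kummer theory on `A₀, A₁, A₂`, and
the central involution `[-1]` as the square root of `c₆ + Σ_k (c₄ + 6ωᵏδ)U_k`.

## References

* J. H. Silverman, *The Arithmetic of Elliptic Curves*, 2nd ed. (2009), III.1 (`b₂, …, b₈`,
  `c₄, c₆`, `4b₈ = b₂b₆ - b₄²`, `1728Δ = c₄³ - c₆²`, the model `y² = x³ - 27c₄x - 54c₆`),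
  Exercise 3.7 (`ψ₃`). [SilvermanAEC2009]
* J. H. Silverman, *Advanced Topics in the Arithmetic of Elliptic Curves*, GTM 151 (1994), §IV.10
  (`δ(E/K)` through `L = K(E[ℓ])`, PDF p. 358), IV.11.1 (`p = 2`, p. 366). [SilvermanATAEC1994]
* L. Bandini, L. Paladino, *Number fields generated by the 3-torsion points of an elliptic
  curve*, Monatsh. Math. 168 (2012), 157–181 (explicit generators of `ℚ(E[3])`; cited for
  context only — the identities below are proved directly by `ring`).

## Design

Theorems only, over a commutative ring, with the radicals as elements carrying hypotheses
(`hω : ω ^ 2 + ω + 1 = 0`, `h₀ : U₀ ^ 2 = c₄ - 12 * δ`, …), so that users over `K̄` or over a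
completion instantiate them freely; all identities are closed by `ring` / `linear_combination`.
Namespace `Literature.NumberTheory.EllipticCurves.ThreeTorsionRadicals` for the pure radical
identities, `WeierstrassCurve` (dot notation on `W`) for the statements with `Ψ₃`, `Ψ₂Sq`, `bᵢ`,
`cᵢ`.  Axioms: `propext`, `Classical.choice`, `Quot.sound`.
-/

open Polynomial

namespace Literature.NumberTheory.EllipticCurves.ThreeTorsionRadicals

variable {R : Type*} [CommRing R]

/-- `∏_k (c₄ - 12ωᵏδ) = c₄³ - 1728δ³` for `ω² + ω + 1 = 0`. [folklore] -/
theorem prod_c₄_sub_twelve_mul {c₄ δ ω : R} (hω : ω ^ 2 + ω + 1 = 0) :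
    (c₄ - 12 * δ) * (c₄ - 12 * ω * δ) * (c₄ - 12 * ω ^ 2 * δ) = c₄ ^ 3 - 1728 * δ ^ 3 := by
  linear_combination (-12 * c₄ ^ 2 * δ + 144 * c₄ * δ ^ 2 * ω - 1728 * δ ^ 3 * (ω - 1)) * hω

/-- `Σ_k (c₄ - 12ωᵏδ) = 3c₄` for `ω² + ω + 1 = 0`. [folklore] -/
theorem sum_c₄_sub_twelve_mul {c₄ δ ω : R} (hω : ω ^ 2 + ω + 1 = 0) :
    (c₄ - 12 * δ) + (c₄ - 12 * ω * δ) + (c₄ - 12 * ω ^ 2 * δ) = 3 * c₄ := by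
  linear_combination (-12 * δ) * hω

section Radicals

variable {c₄ c₆ δ ω U₀ U₁ U₂ : R}

/-- `(U₀ + U₁ + U₂)² = 3c₄ + 2(U₀U₁ + U₀U₂ + U₁U₂)` (`Σ_k A_k = 3c₄`). [folklore] -/
theorem sum_sq_eq (hω : ω ^ 2 + ω + 1 = 0) (h₀ : U₀ ^ 2 = c₄ - 12 * δ)
    (h₁ : U₁ ^ 2 = c₄ - 12 * ω * δ) (h₂ : U₂ ^ 2 = c₄ - 12 * ω ^ 2 * δ) :
    (U₀ + U₁ + U₂) ^ 2 = 3 * c₄ + 2 * (U₀ * U₁ + U₀ * U₂ + U₁ * U₂) := by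
  linear_combination h₀ + h₁ + h₂ + (-12 * δ) * hω

/-- `(U₀U₁ + U₀U₂ + U₁U₂)² = 3c₄² + 2c₆(U₀ + U₁ + U₂)` (`Σ_{k<l} A_kA_l = 3c₄²`,
`U₀U₁U₂ = c₆`). [folklore] -/
theorem sum_pair_mul_sq_eq (hω : ω ^ 2 + ω + 1 = 0) (h₀ : U₀ ^ 2 = c₄ - 12 * δ)
    (h₁ : U₁ ^ 2 = c₄ - 12 * ω * δ) (h₂ : U₂ ^ 2 = c₄ - 12 * ω ^ 2 * δ)
    (hp : U₀ * U₁ * U₂ = c₆) :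
    (U₀ * U₁ + U₀ * U₂ + U₁ * U₂) ^ 2 = 3 * c₄ ^ 2 + 2 * c₆ * (U₀ + U₁ + U₂) := by
  linear_combination (U₁ ^ 2 + U₂ ^ 2) * h₀ + ((c₄ - 12 * δ) + U₂ ^ 2) * h₁
    + ((c₄ - 12 * δ) + (c₄ - 12 * ω * δ)) * h₂ + 2 * (U₀ + U₁ + U₂) * hp
    + (-24 * c₄ * δ + 144 * δ ^ 2 * ω) * hω

/-- **Euler's solution of the `3`-division quartic: `Q(U₀ + U₁ + U₂) = 0`**,
`Q(z) = z⁴ - 6c₄z² - 8c₆z - 3c₄²`, for `ω² + ω + 1 = 0`, `U_k² = c₄ - 12ωᵏδ`, `U₀U₁U₂ = c₆`.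
[folklore] -/
theorem quartic_eval_sum_eq_zero (hω : ω ^ 2 + ω + 1 = 0) (h₀ : U₀ ^ 2 = c₄ - 12 * δ)
    (h₁ : U₁ ^ 2 = c₄ - 12 * ω * δ) (h₂ : U₂ ^ 2 = c₄ - 12 * ω ^ 2 * δ)
    (hp : U₀ * U₁ * U₂ = c₆) :
    (U₀ + U₁ + U₂) ^ 4 - 6 * c₄ * (U₀ + U₁ + U₂) ^ 2 - 8 * c₆ * (U₀ + U₁ + U₂) - 3 * c₄ ^ 2
      = 0 := by
  have hz2 := sum_sq_eq hω h₀ h₁ h₂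
  have hS2 := sum_pair_mul_sq_eq hω h₀ h₁ h₂ hp
  linear_combination ((U₀ + U₁ + U₂) ^ 2 - 3 * c₄ + 2 * (U₀ * U₁ + U₀ * U₂ + U₁ * U₂)) * hz2
    + 4 * hS2

/-- `z (U₀U₁ + U₀U₂ + U₁U₂) = 3c₄z - Σ_k A_kU_k + 3c₆` at `z = U₀ + U₁ + U₂`. [folklore] -/
theorem sum_mul_sum_pair_mul_eq (hω : ω ^ 2 + ω + 1 = 0) (h₀ : U₀ ^ 2 = c₄ - 12 * δ)
    (h₁ : U₁ ^ 2 = c₄ - 12 * ω * δ) (h₂ : U₂ ^ 2 = c₄ - 12 * ω ^ 2 * δ)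
    (hp : U₀ * U₁ * U₂ = c₆) :
    (U₀ + U₁ + U₂) * (U₀ * U₁ + U₀ * U₂ + U₁ * U₂) =
      3 * c₄ * (U₀ + U₁ + U₂)
        - ((c₄ - 12 * δ) * U₀ + (c₄ - 12 * ω * δ) * U₁ + (c₄ - 12 * ω ^ 2 * δ) * U₂)
        + 3 * c₆ := by
  linear_combination (U₁ + U₂) * h₀ + (U₀ + U₂) * h₁ + (U₀ + U₁) * h₂ + 3 * hp
    + (-12 * δ * (U₀ + U₁ + U₂)) * hω

/-- **The cubic at the root: `z³ - 3c₄z - 2c₆ = 4(c₆ + Σ_k (c₄ + 6ωᵏδ)U_k)`** at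
`z = U₀ + U₁ + U₂` (this is `432 · (4x³ + b₂x² + 2b₄x + b₆)` at `12x + b₂ = z`,
`WeierstrassCurve.mul_Ψ₂Sq_eval_eq`, i.e. `432 (2y + a₁x + a₃)²` on the curve). [folklore] -/
theorem cube_sum_sub_eq (hω : ω ^ 2 + ω + 1 = 0) (h₀ : U₀ ^ 2 = c₄ - 12 * δ)
    (h₁ : U₁ ^ 2 = c₄ - 12 * ω * δ) (h₂ : U₂ ^ 2 = c₄ - 12 * ω ^ 2 * δ)
    (hp : U₀ * U₁ * U₂ = c₆) :
    (U₀ + U₁ + U₂) ^ 3 - 3 * c₄ * (U₀ + U₁ + U₂) - 2 * c₆ =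
      4 * (c₆ + (c₄ + 6 * δ) * U₀ + (c₄ + 6 * ω * δ) * U₁ + (c₄ + 6 * ω ^ 2 * δ) * U₂) := by
  have hz2 := sum_sq_eq hω h₀ h₁ h₂
  have hzS := sum_mul_sum_pair_mul_eq hω h₀ h₁ h₂ hp
  linear_combination (U₀ + U₁ + U₂) * hz2 + 2 * hzS

/-- **The resolvent: `(-b₂ + U₀ + U₁ + U₂)(-b₂ + U₀ - U₁ - U₂) + (-b₂ - U₀ + U₁ - U₂)(-b₂ - U₀ - U₁ + U₂)
 = 48(b₄ - δ)`** when `c₄ = b₂² - 24b₄` — the two pairs of roots `12x + b₂ = ±U₀ ± ⋯` sharing the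
sign of `U₀` have `(12x₁)(12x₂) + (12x₃)(12x₄) = 48(b₄ - δ)`, i.e. `x₁x₂ + x₃x₄ = (b₄ - δ)/3`: the
resolvent cubic of `Ψ₃/3` is `(θ - b₄/3)³ + δ³/27`. [folklore] -/
theorem pair_mul_add_pair_mul_eq {b₂ b₄ : R} (hω : ω ^ 2 + ω + 1 = 0)
    (h₀ : U₀ ^ 2 = c₄ - 12 * δ) (h₁ : U₁ ^ 2 = c₄ - 12 * ω * δ)
    (h₂ : U₂ ^ 2 = c₄ - 12 * ω ^ 2 * δ) (hc₄ : c₄ = b₂ ^ 2 - 24 * b₄) :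
    (-b₂ + U₀ + U₁ + U₂) * (-b₂ + U₀ - U₁ - U₂) + (-b₂ - U₀ + U₁ - U₂) * (-b₂ - U₀ - U₁ + U₂)
      = 48 * (b₄ - δ) := by
  linear_combination 2 * h₀ - 2 * h₁ - 2 * h₂ - 2 * hc₄ + 24 * δ * hω

/-- The resolvent value for the two pairs sharing the sign of `U₁`: `48(b₄ - ωδ)`. [folklore] -/
theorem pair_mul_add_pair_mul_eq_one {b₂ b₄ : R} (hω : ω ^ 2 + ω + 1 = 0)
    (h₀ : U₀ ^ 2 = c₄ - 12 * δ) (h₁ : U₁ ^ 2 = c₄ - 12 * ω * δ)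
    (h₂ : U₂ ^ 2 = c₄ - 12 * ω ^ 2 * δ) (hc₄ : c₄ = b₂ ^ 2 - 24 * b₄) :
    (-b₂ + U₀ + U₁ + U₂) * (-b₂ - U₀ + U₁ - U₂) + (-b₂ + U₀ - U₁ - U₂) * (-b₂ - U₀ - U₁ + U₂)
      = 48 * (b₄ - ω * δ) := by
  linear_combination 2 * h₁ - 2 * h₀ - 2 * h₂ - 2 * hc₄ + 24 * δ * hω

/-- The resolvent value for the two pairs sharing the sign of `U₂`: `48(b₄ - ω²δ)`. [folklore] -/
theorem pair_mul_add_pair_mul_eq_two {b₂ b₄ : R} (hω : ω ^ 2 + ω + 1 = 0)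
    (h₀ : U₀ ^ 2 = c₄ - 12 * δ) (h₁ : U₁ ^ 2 = c₄ - 12 * ω * δ)
    (h₂ : U₂ ^ 2 = c₄ - 12 * ω ^ 2 * δ) (hc₄ : c₄ = b₂ ^ 2 - 24 * b₄) :
    (-b₂ + U₀ + U₁ + U₂) * (-b₂ - U₀ - U₁ + U₂) + (-b₂ + U₀ - U₁ - U₂) * (-b₂ - U₀ + U₁ - U₂)
      = 48 * (b₄ - ω ^ 2 * δ) := by
  linear_combination 2 * h₂ - 2 * h₀ - 2 * h₁ - 2 * hc₄ + 24 * δ * hω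

/-- `U₀² - U₁² = 12(ω - 1)δ`: the differences of the radicands (so the four roots
`(-b₂ ± U₀ ± U₁ ± U₂)/12` are pairwise distinct as soon as `(ω - 1)δ`, `(ω² - 1)δ`, `(ω² - ω)δ` and
`2` are not zero divisors). [folklore] -/
theorem sq_sub_sq_zero_one (h₀ : U₀ ^ 2 = c₄ - 12 * δ) (h₁ : U₁ ^ 2 = c₄ - 12 * ω * δ) :
    U₀ ^ 2 - U₁ ^ 2 = 12 * (ω - 1) * δ := by
  linear_combination h₀ - h₁

/-- `U₀² - U₂² = 12(ω² - 1)δ`. [folklore] -/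
theorem sq_sub_sq_zero_two (h₀ : U₀ ^ 2 = c₄ - 12 * δ) (h₂ : U₂ ^ 2 = c₄ - 12 * ω ^ 2 * δ) :
    U₀ ^ 2 - U₂ ^ 2 = 12 * (ω ^ 2 - 1) * δ := by
  linear_combination h₀ - h₂

/-- `U₁² - U₂² = 12(ω² - ω)δ`. [folklore] -/
theorem sq_sub_sq_one_two (h₁ : U₁ ^ 2 = c₄ - 12 * ω * δ) (h₂ : U₂ ^ 2 = c₄ - 12 * ω ^ 2 * δ) :
    U₁ ^ 2 - U₂ ^ 2 = 12 * (ω ^ 2 - ω) * δ := by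
  linear_combination h₁ - h₂

end Radicals

/-- **Existence of the radicals over an algebraically closed field**: `ω` with `ω² + ω + 1 = 0`,
`δ` with `δ³ = Δ`, and `U₀, U₁, U₂` with `U_k² = c₄ - 12ωᵏδ`, `U₀U₁U₂ = c₆`, for any `c₄, c₆, Δ`
with `1728Δ = c₄³ - c₆²` (the sign of the last square root is adjusted so that the product is
`c₆` rather than `-c₆`). [folklore] -/
theorem exists_radicals {F : Type*} [Field F] [IsAlgClosed F] (c₄ c₆ Δ : F)
    (hc : 1728 * Δ = c₄ ^ 3 - c₆ ^ 2) :
    ∃ ω δ U₀ U₁ U₂ : F, ω ^ 2 + ω + 1 = 0 ∧ δ ^ 3 = Δ ∧ U₀ ^ 2 = c₄ - 12 * δ ∧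
      U₁ ^ 2 = c₄ - 12 * ω * δ ∧ U₂ ^ 2 = c₄ - 12 * ω ^ 2 * δ ∧ U₀ * U₁ * U₂ = c₆ := by
  -- `ω`: a root of `X² + X + 1`
  obtain ⟨ω, hω⟩ : ∃ ω : F, ω ^ 2 + ω + 1 = 0 := by
    have hdeg : (C 1 * X ^ 2 + C 1 * X + C 1 : F[X]).degree = 2 := degree_quadratic one_ne_zero
    obtain ⟨ω, hω⟩ := IsAlgClosed.exists_root (C 1 * X ^ 2 + C 1 * X + C 1 : F[X])
      (by rw [hdeg]; decide)
    refine ⟨ω, ?_⟩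
    have := hω.eq_zero
    simpa using this
  -- `δ`: a cube root of `Δ`
  obtain ⟨δ, hδ⟩ := IsAlgClosed.exists_pow_nat_eq Δ (by norm_num : 0 < 3)
  -- square roots of `A₀`, `A₁`, `A₂`
  obtain ⟨U₀, hU₀⟩ := IsAlgClosed.exists_pow_nat_eq (c₄ - 12 * δ) (by norm_num : 0 < 2)
  obtain ⟨U₁, hU₁⟩ := IsAlgClosed.exists_pow_nat_eq (c₄ - 12 * ω * δ) (by norm_num : 0 < 2)
  obtain ⟨V₂, hV₂⟩ := IsAlgClosed.exists_pow_nat_eq (c₄ - 12 * ω ^ 2 * δ) (by norm_num : 0 < 2)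
  -- the product of the three squares is `c₆²`
  have hprod : (U₀ * U₁ * V₂) ^ 2 = c₆ ^ 2 := by
    have e := prod_c₄_sub_twelve_mul (c₄ := c₄) (δ := δ) hω
    rw [mul_pow, mul_pow, hU₀, hU₁, hV₂, e, hδ]
    linear_combination -hc
  -- so `U₀U₁V₂ = ±c₆`; fix the sign of the last root
  rcases sq_eq_sq_iff_eq_or_eq_neg.mp hprod with h | h
  · exact ⟨ω, δ, U₀, U₁, V₂, hω, hδ, hU₀, hU₁, hV₂, h⟩
  · exact ⟨ω, δ, U₀, U₁, -V₂, hω, hδ, hU₀, hU₁, by rw [neg_sq, hV₂], by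
      rw [mul_neg, h, neg_neg]⟩

end Literature.NumberTheory.EllipticCurves.ThreeTorsionRadicals

namespace WeierstrassCurve

open Literature.NumberTheory.EllipticCurves.ThreeTorsionRadicals

variable {R : Type*} [CommRing R] (W : WeierstrassCurve R)

/-- **`12⁴ · Ψ₃(x) = 3 · Q(12x + b₂)`, `Q(z) = z⁴ - 6c₄z² - 8c₆z - 3c₄²`** (uses
`4b₈ = b₂b₆ - b₄²`): the `3`-division polynomial in the coordinate `z = 12x + b₂` of the
`c₄`–`c₆` model.  Silverman, *AEC* III.1 and Ex. 3.7. [cite: SilvermanAEC2009, III.1 and Exercise 3.7] -/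
theorem twelve_pow_four_mul_eval_Ψ₃ (x : R) :
    12 ^ 4 * W.Ψ₃.eval x =
      3 * ((12 * x + W.b₂) ^ 4 - 6 * W.c₄ * (12 * x + W.b₂) ^ 2 - 8 * W.c₆ * (12 * x + W.b₂)
        - 3 * W.c₄ ^ 2) := by
  simp only [Ψ₃, eval_add, eval_mul, eval_pow, eval_C, eval_X, eval_ofNat, c₄, c₆]
  linear_combination (5184 : R) * W.b_relation

/-- **`432 · (4x³ + b₂x² + 2b₄x + b₆) = z³ - 3c₄z - 2c₆`**, `z = 12x + b₂` (the cubic of the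
`c₄`–`c₆` model; `Ψ₂Sq = 4X³ + b₂X² + 2b₄X + b₆`).  Silverman, *AEC* III.1.
[cite: SilvermanAEC2009, III.1] -/
theorem mul_Ψ₂Sq_eval_eq (x : R) :
    432 * W.Ψ₂Sq.eval x = (12 * x + W.b₂) ^ 3 - 3 * W.c₄ * (12 * x + W.b₂) - 2 * W.c₆ := by
  simp only [Ψ₂Sq, eval_add, eval_mul, eval_pow, eval_C, eval_X, c₄, c₆]
  ring

/-- On the curve, `(2y + a₁x + a₃)² = 4x³ + b₂x² + 2b₄x + b₆ = Ψ₂Sq(x)` (completing the square).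
Silverman, *AEC* III.1. [cite: SilvermanAEC2009, III.1] -/
theorem sq_two_mul_add_eq_of_equation {x y : R} (h : W.toAffine.Equation x y) :
    (2 * y + W.a₁ * x + W.a₃) ^ 2 = W.Ψ₂Sq.eval x := by
  have h' : y ^ 2 + W.a₁ * x * y + W.a₃ * y - (x ^ 3 + W.a₂ * x ^ 2 + W.a₄ * x + W.a₆) = 0 := by
    rw [Affine.equation_iff] at h
    exact sub_eq_zero.mpr h
  simp only [Ψ₂Sq, eval_add, eval_mul, eval_pow, eval_C, eval_X, b₂, b₄, b₆]
  linear_combination (4 : R) * h'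

/-- Conversely, `(2y + a₁x + a₃)² = Ψ₂Sq(x)` gives the equation when `2` is a unit. [folklore] -/
theorem equation_of_sq_two_mul_add_eq (h2 : IsUnit (2 : R)) {x y : R}
    (h : (2 * y + W.a₁ * x + W.a₃) ^ 2 = W.Ψ₂Sq.eval x) : W.toAffine.Equation x y := by
  simp only [Ψ₂Sq, eval_add, eval_mul, eval_pow, eval_C, eval_X, b₂, b₄, b₆] at h
  have h4 : (2 * 2 : R) *
      (y ^ 2 + W.a₁ * x * y + W.a₃ * y - (x ^ 3 + W.a₂ * x ^ 2 + W.a₄ * x + W.a₆)) = 0 := by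
    linear_combination h
  have h0 := ((h2.mul h2).mul_right_eq_zero).mp h4
  rw [Affine.equation_iff]
  exact sub_eq_zero.mp h0

section Radicals

variable {δ ω U₀ U₁ U₂ : R}

/-- **`12⁴ Ψ₃(x) = 0` at `12x + b₂ = U₀ + U₁ + U₂`** (any commutative ring), for
`ω² + ω + 1 = 0`, `U_k² = c₄ - 12ωᵏδ`, `U₀U₁U₂ = c₆`. [folklore] -/
theorem twelve_pow_four_mul_eval_Ψ₃_eq_zero (hω : ω ^ 2 + ω + 1 = 0)
    (h₀ : U₀ ^ 2 = W.c₄ - 12 * δ) (h₁ : U₁ ^ 2 = W.c₄ - 12 * ω * δ)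
    (h₂ : U₂ ^ 2 = W.c₄ - 12 * ω ^ 2 * δ) (hp : U₀ * U₁ * U₂ = W.c₆) {x : R}
    (hx : 12 * x + W.b₂ = U₀ + U₁ + U₂) :
    12 ^ 4 * W.Ψ₃.eval x = 0 := by
  rw [twelve_pow_four_mul_eval_Ψ₃, hx, quartic_eval_sum_eq_zero hω h₀ h₁ h₂ hp, mul_zero]

/-- **`Ψ₃(x) = 0` at `x = (-b₂ + U₀ + U₁ + U₂)/12`** when `12` is a unit (e.g. over a field of
characteristic prime to `6`): the `x`-coordinates of `E[3] ∖ O` by radicals.  The other three roots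
come from the sign changes `(U₀, -U₁, -U₂)`, `(-U₀, U₁, -U₂)`, `(-U₀, -U₁, U₂)`, which preserve the
hypotheses. [folklore] -/
theorem eval_Ψ₃_eq_zero_of_twelve_mul_add_eq (h12 : IsUnit (12 : R)) (hω : ω ^ 2 + ω + 1 = 0)
    (h₀ : U₀ ^ 2 = W.c₄ - 12 * δ) (h₁ : U₁ ^ 2 = W.c₄ - 12 * ω * δ)
    (h₂ : U₂ ^ 2 = W.c₄ - 12 * ω ^ 2 * δ) (hp : U₀ * U₁ * U₂ = W.c₆) {x : R}
    (hx : 12 * x + W.b₂ = U₀ + U₁ + U₂) : W.Ψ₃.eval x = 0 := by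
  have := W.twelve_pow_four_mul_eval_Ψ₃_eq_zero hω h₀ h₁ h₂ hp hx
  exact ((h12.pow 4).mul_right_eq_zero).mp this

/-- **`432 · Ψ₂Sq(x) = 4 (c₆ + Σ_k (c₄ + 6ωᵏδ)U_k)` at `12x + b₂ = U₀ + U₁ + U₂`** (any
commutative ring). [folklore] -/
theorem mul_Ψ₂Sq_eval_eq_four_mul (hω : ω ^ 2 + ω + 1 = 0)
    (h₀ : U₀ ^ 2 = W.c₄ - 12 * δ) (h₁ : U₁ ^ 2 = W.c₄ - 12 * ω * δ)
    (h₂ : U₂ ^ 2 = W.c₄ - 12 * ω ^ 2 * δ) (hp : U₀ * U₁ * U₂ = W.c₆) {x : R}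
    (hx : 12 * x + W.b₂ = U₀ + U₁ + U₂) :
    432 * W.Ψ₂Sq.eval x =
      4 * (W.c₆ + (W.c₄ + 6 * δ) * U₀ + (W.c₄ + 6 * ω * δ) * U₁ + (W.c₄ + 6 * ω ^ 2 * δ) * U₂) := by
  rw [mul_Ψ₂Sq_eval_eq, hx, cube_sum_sub_eq hω h₀ h₁ h₂ hp]

/-- **`108 · Ψ₂Sq(x) = c₆ + Σ_k (c₄ + 6ωᵏδ)U_k` at `12x + b₂ = U₀ + U₁ + U₂`** when `2` is a unit,
i.e. on the curve `108 (2y + a₁x + a₃)² = c₆ + Σ_k (c₄ + 6ωᵏδ)U_k`: the Kummer generator of the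
quadratic layer `K(E[3]) / K(x(E[3]))`. [folklore] -/
theorem mul_Ψ₂Sq_eval_eq_of_twelve_mul_add_eq (h2 : IsUnit (2 : R)) (hω : ω ^ 2 + ω + 1 = 0)
    (h₀ : U₀ ^ 2 = W.c₄ - 12 * δ) (h₁ : U₁ ^ 2 = W.c₄ - 12 * ω * δ)
    (h₂ : U₂ ^ 2 = W.c₄ - 12 * ω ^ 2 * δ) (hp : U₀ * U₁ * U₂ = W.c₆) {x : R}
    (hx : 12 * x + W.b₂ = U₀ + U₁ + U₂) :
    108 * W.Ψ₂Sq.eval x =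
      W.c₆ + (W.c₄ + 6 * δ) * U₀ + (W.c₄ + 6 * ω * δ) * U₁ + (W.c₄ + 6 * ω ^ 2 * δ) * U₂ := by
  have h432 := W.mul_Ψ₂Sq_eval_eq_four_mul hω h₀ h₁ h₂ hp hx
  have h4 : (2 * 2 : R) * (108 * W.Ψ₂Sq.eval x -
      (W.c₆ + (W.c₄ + 6 * δ) * U₀ + (W.c₄ + 6 * ω * δ) * U₁ + (W.c₄ + 6 * ω ^ 2 * δ) * U₂)) = 0 := by
    linear_combination h432
  exact sub_eq_zero.mp (((h2.mul h2).mul_right_eq_zero).mp h4)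

/-- On the curve (with `2` a unit), at `12x + b₂ = U₀ + U₁ + U₂`:
`108 (2y + a₁x + a₃)² = c₆ + Σ_k (c₄ + 6ωᵏδ)U_k`. [folklore] -/
theorem mul_sq_two_mul_add_eq (h2 : IsUnit (2 : R)) (hω : ω ^ 2 + ω + 1 = 0)
    (h₀ : U₀ ^ 2 = W.c₄ - 12 * δ) (h₁ : U₁ ^ 2 = W.c₄ - 12 * ω * δ)
    (h₂ : U₂ ^ 2 = W.c₄ - 12 * ω ^ 2 * δ) (hp : U₀ * U₁ * U₂ = W.c₆) {x y : R}
    (h : W.toAffine.Equation x y) (hx : 12 * x + W.b₂ = U₀ + U₁ + U₂) :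
    108 * (2 * y + W.a₁ * x + W.a₃) ^ 2 =
      W.c₆ + (W.c₄ + 6 * δ) * U₀ + (W.c₄ + 6 * ω * δ) * U₁ + (W.c₄ + 6 * ω ^ 2 * δ) * U₂ := by
  rw [W.sq_two_mul_add_eq_of_equation h]
  exact W.mul_Ψ₂Sq_eval_eq_of_twelve_mul_add_eq h2 hω h₀ h₁ h₂ hp hx

/-- **`∛Δ ∈ K(x(E[3]))`: `144 (x₁x₂ + x₃x₄) = 48 (b₄ - δ)`** for the roots `x₁, x₂` with
`12x + b₂ = U₀ ± (U₁ + U₂)` and `x₃, x₄` with `12x + b₂ = -U₀ ± (U₁ - U₂)`, i.e.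
`x₁x₂ + x₃x₄ = (b₄ - δ)/3`. [folklore] -/
theorem mul_pair_sum_eq (hω : ω ^ 2 + ω + 1 = 0)
    (h₀ : U₀ ^ 2 = W.c₄ - 12 * δ) (h₁ : U₁ ^ 2 = W.c₄ - 12 * ω * δ)
    (h₂ : U₂ ^ 2 = W.c₄ - 12 * ω ^ 2 * δ) {x₁ x₂ x₃ x₄ : R}
    (hx₁ : 12 * x₁ + W.b₂ = U₀ + U₁ + U₂) (hx₂ : 12 * x₂ + W.b₂ = U₀ - U₁ - U₂)
    (hx₃ : 12 * x₃ + W.b₂ = -U₀ + U₁ - U₂) (hx₄ : 12 * x₄ + W.b₂ = -U₀ - U₁ + U₂) :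
    144 * (x₁ * x₂ + x₃ * x₄) = 48 * (W.b₄ - δ) := by
  have e := pair_mul_add_pair_mul_eq (b₂ := W.b₂) (b₄ := W.b₄) hω h₀ h₁ h₂ (rfl : W.c₄ = _)
  linear_combination e + (12 * x₁) * hx₂ + (-W.b₂ + U₀ - U₁ - U₂) * hx₁
    + (12 * x₃) * hx₄ + (-W.b₂ - U₀ - U₁ + U₂) * hx₃

/-- `144 (x₁x₃ + x₂x₄) = 48 (b₄ - ωδ)` (the pairs sharing the sign of `U₁`). [folklore] -/
theorem mul_pair_sum_eq_one (hω : ω ^ 2 + ω + 1 = 0)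
    (h₀ : U₀ ^ 2 = W.c₄ - 12 * δ) (h₁ : U₁ ^ 2 = W.c₄ - 12 * ω * δ)
    (h₂ : U₂ ^ 2 = W.c₄ - 12 * ω ^ 2 * δ) {x₁ x₂ x₃ x₄ : R}
    (hx₁ : 12 * x₁ + W.b₂ = U₀ + U₁ + U₂) (hx₂ : 12 * x₂ + W.b₂ = U₀ - U₁ - U₂)
    (hx₃ : 12 * x₃ + W.b₂ = -U₀ + U₁ - U₂) (hx₄ : 12 * x₄ + W.b₂ = -U₀ - U₁ + U₂) :
    144 * (x₁ * x₃ + x₂ * x₄) = 48 * (W.b₄ - ω * δ) := by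
  have e := pair_mul_add_pair_mul_eq_one (b₂ := W.b₂) (b₄ := W.b₄) hω h₀ h₁ h₂ (rfl : W.c₄ = _)
  linear_combination e + (12 * x₁) * hx₃ + (-W.b₂ - U₀ + U₁ - U₂) * hx₁
    + (12 * x₂) * hx₄ + (-W.b₂ - U₀ - U₁ + U₂) * hx₂

/-- `144 (x₁x₄ + x₂x₃) = 48 (b₄ - ω²δ)` (the pairs sharing the sign of `U₂`). [folklore] -/
theorem mul_pair_sum_eq_two (hω : ω ^ 2 + ω + 1 = 0)
    (h₀ : U₀ ^ 2 = W.c₄ - 12 * δ) (h₁ : U₁ ^ 2 = W.c₄ - 12 * ω * δ)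
    (h₂ : U₂ ^ 2 = W.c₄ - 12 * ω ^ 2 * δ) {x₁ x₂ x₃ x₄ : R}
    (hx₁ : 12 * x₁ + W.b₂ = U₀ + U₁ + U₂) (hx₂ : 12 * x₂ + W.b₂ = U₀ - U₁ - U₂)
    (hx₃ : 12 * x₃ + W.b₂ = -U₀ + U₁ - U₂) (hx₄ : 12 * x₄ + W.b₂ = -U₀ - U₁ + U₂) :
    144 * (x₁ * x₄ + x₂ * x₃) = 48 * (W.b₄ - ω ^ 2 * δ) := by
  have e := pair_mul_add_pair_mul_eq_two (b₂ := W.b₂) (b₄ := W.b₄) hω h₀ h₁ h₂ (rfl : W.c₄ = _)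
  linear_combination e + (12 * x₁) * hx₄ + (-W.b₂ - U₀ - U₁ + U₂) * hx₁
    + (12 * x₂) * hx₃ + (-W.b₂ - U₀ + U₁ - U₂) * hx₂

end Radicals

end WeierstrassCurve
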